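import Summits.NavierStokesRegularity.TurbBounds.Certs.N1bG2n16.EvalData4
import Summits.NavierStokesRegularity.TurbBounds.TailP2R4ModeN16p2
import Summits.NavierStokesRegularity.TurbBounds.TailN1bG2n16LadderForms
import Summits.NavierStokesRegularity.TurbBounds.TailN1bG2n16Ext
import Summits.NavierStokesRegularity.TurbBounds.QuadFormEval
import HarnessLib

/-!
# Row RB-N1b tail lemma (dim 50) — structured quadratic form of the literal rule piece `CE2`, part 8/16 (v2.1: list-level evaluation)
(cell `pub-turb` / `turb-bounds`; v2; the coupling-mode lemma is REUSED from the earlier-landing row `TailP2R4.N16` (same (N, P); gen 8 reuse_modes.py — no re-declaration of (N,P)-generic facts); GENERATED by pub-turb-cert gen 8 (prover-pub-turb-cert-g8-0) running the gen-7 tool `emit_pieces_v21.py N1bG2n16` from the staged `Certs/N1bG2n16/EvalData*.lean`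
literals; the identity says 'this literal (projected) piece IS the Legendre–Galerkin object of rbsdp SPEC 3.3–3.6 on the kept coordinates'
(LEAN-MAP data item (a) for row RB-N1b). Proof: `QuadFormEval.dotProduct_mulVec_eq_rowsEval` turns the quadratic form into a structural
recursion over the row lists (unfolded by `simp only`, linear in the 1001 listed entries), then `ring` over the ladder forms.)

HONEST FRAMING: rigorous bounds for the stated PDE and boundary conditions; no claim about physical turbulence beyond the bound.
-/

set_option linter.style.longLine false
set_option linter.style.setOption false
set_option maxRecDepth 100000

noncomputable section

namespace Summit.NavierStokesRegularity.TurbBounds.TailN1bG2n16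

open Finset Matrix Literature.Computation.Certificates
open Summit.NavierStokesRegularity.TurbBounds.LadderTail (w phi lam)
open Summit.NavierStokesRegularity.TurbBounds.CouplingSplit (couplingMode)
open Summit.NavierStokesRegularity.TurbBounds.TailP2R4.N16 (couplingMode_2_eq)
open Summit.NavierStokesRegularity.TurbBounds.Certs.N1bG2n16.Evaluator

set_option maxHeartbeats 20000000 in
/-- structured quadratic form of the literal piece `CE2` (50×50 kept coordinates, 1001 listed / 188 nonzero entries) — twice the exact coupling form of profile mode 2 at the ladder coefficients -/
theorem quadForm_CE2 (x : Fin 50 → ℝ) :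
    x ⬝ᵥ (CE2.map (Rat.cast : ℚ → ℝ) *ᵥ x) = 2 * couplingMode 16 8 2 (bL x) (eL x) := by
  rw [couplingMode_2_eq]
  rw [show CE2 = matrixOfRows 50 50 CE2_rows from rfl,
    QuadFormEval.dotProduct_mulVec_eq_rowsEval CE2_rows x (ext x) (ext_val x) (ext_zero x)]
  simp only [CE2_rows, CE2_rows_r0, CE2_rows_r1, CE2_rows_r2, CE2_rows_r3, CE2_rows_r4, CE2_rows_r5, CE2_rows_r6, CE2_rows_r7, CE2_rows_r8, CE2_rows_r9, CE2_rows_r10, CE2_rows_r11, CE2_rows_r12, CE2_rows_r13, CE2_rows_r14, CE2_rows_r15, CE2_rows_r16, CE2_rows_r17, CE2_rows_r18, CE2_rows_r19, CE2_rows_r20, CE2_rows_r21, CE2_rows_r22, CE2_rows_r23, CE2_rows_r24, CE2_rows_r25, CE2_rows_r26, CE2_rows_r27, CE2_rows_r28, CE2_rows_r29, CE2_rows_r30, CE2_rows_r31, CE2_rows_r32, CE2_rows_r33, CE2_rows_r34, CE2_rows_r35, CE2_rows_r36, CE2_rows_r37, CE2_rows_r38, CE2_rows_r39, CE2_rows_r40,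 CE2_rows_r41, CE2_rows_r42, CE2_rows_r43, CE2_rows_r44, CE2_rows_r45, CE2_rows_r46, CE2_rows_r47, CE2_rows_r48, CE2_rows_r49,
    QuadFormEval.rowsEval_cons, QuadFormEval.rowsEval_nil, QuadFormEval.rowEval_cons, QuadFormEval.rowEval_nil, ext, Rat.cast_zero, zero_mul, mul_zero, zero_add, add_zero,
    bL, aL, eL, xc, xd]
  push_cast
  ring

end Summit.NavierStokesRegularity.TurbBounds.TailN1bG2n16

end
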